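import Literature.AnabelianGeometry.SemiGraphs.TemperedDLocTransport
import HarnessLib

/-!
# [SemiAnbd] Theorem 6.8 (i), (iii), (iv): the printed proof cut into intermediate STATEMENTS (sub-DAG)

Mochizuki, *Semi-graphs of anabelioids*, Publ. RIMS **42** (2006) [SemiAnbd], §6, Thm. 6.8 (Tempered
Group-theoreticity of the Category of Dominant Localizations), ms. pp. 74–75.  Printed proof (p. 75):
"In light of Theorems 6.4, 6.5, the present Theorem 6.8 follows by exactly the same arguments as those
applied in [Mzk8] to prove [Mzk8], Theorem 2.3; Corollaries 2.5, 2.6, 2.8"; Rmk. 6.8.1: (iii), (iv)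
"only require the isomorphism version of Theorem 6.4 [cf. [Mzk8], Remark 2.8.1]".  [Mzk8] = *Galois
sections in absolute anabelian geometry*, Nagoya Math. J. **179** (2005), §2, ms. pp. 7–12 (Def. 2.1,
Thm. 2.3, Def. 2.4, Cor. 2.5, Cor. 2.6, Def. 2.7, Cor. 2.8, Rmk. 2.8.1, with proofs) — these ARGUMENTS
are the content of the printed proof. [cite: MochizukiSemiAnbd2006, Thm 6.8 pp.74-75]
[cite: MochizukiGalSect2005, §2 pp.7-12]

abc-iut cell, layer L3, D-0068 (1) statements-first sub-DAG (index: `plan/L3/SUBDAG-SemiAnbd-Thm68.md`).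
Over the FROZEN interfaces `TemperedCurve p`, `DLocObj X`, `TemperedCurve.CurveArithmeticFlags`,
`TemperedCurve.IsTemperedDLocType` and abc-iut-L3-t4's genuine-morphism category
`DLocObj.dlocCategory X` with its scheme-side datum `DLocSchemeData X`, one `def … : Prop` per
intermediate statement of the [Mzk8] §2 arguments transposed to the tempered setting, for clauses
(i), (iii), (iv); clause (ii) is abc-iut-L3-t4's (equivalence half proved modulo Thm. 6.5 (iii),
`DLocObj.isoInducesDLocEquivalence_of_thm65iii`) and is only consumed by name.  Six bookkeeping
steps the printed arguments use tacitly are PROVED (`full_and_faithful_of_bijectiveOnHom`,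
`dlocEquivalence_of_parts`, `le_of_finiteIndex_le_of_commensurator_eq`, `commensurator_inf_eq_of`,
`decompRecovered_of`, `definedOverNumberFieldIff_of`); everything else is a NAMED STATEMENT, never
asserted.  Nothing of [SemiAnbd] §6 / [Mzk8] / [André] / [Belyi] is discharged; no printed statement
is strengthened (reading choices are flagged); scheme-side notions (coverings, partial
compactifications, torsion points, Belyi maps) stay INTERFACE data -- TODO-merge: abc-iut-L4-t1,
abc-iut-L3-t2.  Nothing here takes a side on [IUTchIII] Cor. 3.12.
-/


noncomputable section

namespace Literature.AnabelianGeometry.SemiGraphs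

open scoped Pointwise
open CategoryTheory Topology

universe u

variable {p : ℕ} [Fact p.Prime]

namespace Thm68Sub

/-! ### A. Clause (i): `DLoc_K(X_K) ⥲ DLoc_{G_K}(Π^temp_{X_K})` as essentially surjective + fully faithful

[Mzk8] proof of Thm. 2.3 (i), p. 9: "assertion (i) follows formally from Theorem 1.2" (the
Hom-version of the relative Grothendieck conjecture; tempered rôle: [SemiAnbd] Thm. 6.4).  The
formal argument has an object half (every `H ↠ J` comes from a hyperbolic partial compactification
of a finite étale covering) and a morphism half (Thm. 6.4 for pairs of objects). -/

/-- **T68i-L01 (objects, covering half)** — [SemiAnbd] pp. 73–74 with [Mzk8] Def. 2.1 / p. 8: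
every open subgroup of finite index `H ⊆ Π^temp_{X_K}` is `Π^temp_Y` of a finite étale covering
`Y → X_K`, i.e. the trivial partial compactification `Y ↪ Y` is an object of `DLoc_K(X_K)` whose
image under the tempered fundamental group functor has `H` as its open subgroup and no cusp filled in
(tempered Galois correspondence for coverings of finite degree, [SemiAnbd] §3 / [André] §4).
Scheme side = INTERFACE (`DLocSchemeData`). [cite: MochizukiSemiAnbd2006, §6 pp.73-74] -/
def CoveringObjectOfOpenSubgroup (X : TemperedCurve p) (D : DLocSchemeData X) : Prop :=
  letI := D.catK; letI := DLocObj.dlocCategory X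
  ∀ H : Subgroup X.PiTemp, IsOpen (H : Set X.PiTemp) → H.FiniteIndex →
    ∃ Y : D.DLocK, (D.pi1Functor.obj Y).H = H ∧ (D.pi1Functor.obj Y).gens = ∅

/-- **T68i-L02 (objects, partial-compactification half)** — [Mzk8] Def. 2.1 (i)(ii) p. 7 and the
definition of `DLoc_{G_K}` p. 8 / [SemiAnbd] p. 74: for a finite étale covering `Y → X_K` and a
collection of cusps of `Y` whose inertia groups generate (as a closed normal subgroup of `Π^temp_Y`)
a subgroup `N` with `Π^temp_Y / N` "hyperbolic" (the image of `Δ^temp_X ∩ Π^temp_Y` nonabelian), the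
partial compactification `Y ↪ Z` filling in exactly those cusps is a HYPERBOLIC partial
compactification, hence an object of `DLoc_K(X_K)`, and `Π^temp_Z = Π^temp_Y / N` (cusp-filling
quotient).  Typed as: every group-theoretic object `(H, N)` is hit ON THE NOSE by the functor.
Scheme side = INTERFACE. [cite: MochizukiGalSect2005, Def 2.1 p.7] -/
def ObjectsHitOnTheNose (X : TemperedCurve p) (D : DLocSchemeData X) : Prop :=
  letI := D.catK; letI := DLocObj.dlocCategory X
  ∀ A : DLocObj X, ∃ Z : D.DLocK, (D.pi1Functor.obj Z).H = A.H ∧ (D.pi1Functor.obj Z).N = A.N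

/-- **T68i-L03 (objects ⇒ essential surjectivity)**: the tempered fundamental group functor
`DLoc_K(X_K) → DLoc_{G_K}(Π^temp_{X_K})` is essentially surjective ([Mzk8] Thm. 2.3 (i) p. 9,
object half; [SemiAnbd] Thm. 6.8 (i) p. 74).  (Two group-theoretic objects with the same `H` and the
same kernel `N` are isomorphic in `DLocObj.dlocCategory X` via the identity of `J = H/N`, so
`ObjectsHitOnTheNose` implies this.) [cite: MochizukiSemiAnbd2006, Thm 6.8(i) p.74] -/
def PiFunctorEssSurj (X : TemperedCurve p) (D : DLocSchemeData X) : Prop :=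
  letI := D.catK; letI := DLocObj.dlocCategory X
  D.pi1Functor.EssSurj

/-- **T68i-L04 (morphisms ⇐ Thm. 6.4)** — [Mzk8] p. 9 "assertion (i) follows formally from
Theorem 1.2", tempered rôle [SemiAnbd] Thm. 6.4 pp. 70–71 (`TemperedAnabelianTheorem`) applied to the
pair of hyperbolic curves `Z`, `Z'` underlying two objects: the dominant `K`-morphisms `Z → Z'`
correspond bijectively to the outer homomorphisms `Π^temp_Z → Π^temp_{Z'}` of DOF-type over `G_K` —
i.e. the functor is bijective on every Hom-set. [cite: MochizukiSemiAnbd2006, Thm 6.4 pp.70-71] -/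
def PiFunctorBijectiveOnHom (X : TemperedCurve p) (D : DLocSchemeData X) : Prop :=
  letI := D.catK; letI := DLocObj.dlocCategory X
  ∀ Z Z' : D.DLocK, Function.Bijective (fun f : Z ⟶ Z' => D.pi1Functor.map f)

/-- **T68i-L04a**: the functor is full ([SemiAnbd] Thm. 6.8 (i); [Mzk8] Thm. 2.3 (i), surjectivity
half of Thm. 6.4). [cite: MochizukiSemiAnbd2006, Thm 6.8(i) p.74] -/
def PiFunctorFull (X : TemperedCurve p) (D : DLocSchemeData X) : Prop :=
  letI := D.catK; letI := DLocObj.dlocCategory X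
  D.pi1Functor.Full

/-- **T68i-L04b**: the functor is faithful ([SemiAnbd] Thm. 6.8 (i); [Mzk8] Thm. 2.3 (i),
injectivity half of Thm. 6.4). [cite: MochizukiSemiAnbd2006, Thm 6.8(i) p.74] -/
def PiFunctorFaithful (X : TemperedCurve p) (D : DLocSchemeData X) : Prop :=
  letI := D.catK; letI := DLocObj.dlocCategory X
  D.pi1Functor.Faithful

/-- Bijectivity on Hom-sets gives full and faithful (bookkeeping).
[cite: MochizukiSemiAnbd2006, Thm 6.8(i) p.74] -/
theorem full_and_faithful_of_bijectiveOnHom (X : TemperedCurve p) (D : DLocSchemeData X)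
    (h : PiFunctorBijectiveOnHom X D) : PiFunctorFull X D ∧ PiFunctorFaithful X D := by
  letI := D.catK; letI := DLocObj.dlocCategory X
  exact ⟨⟨fun {Z Z'} => (h Z Z').2⟩, ⟨fun {Z Z'} => (h Z Z').1⟩⟩

/-- **T68i ASSEMBLY** — [SemiAnbd] Thm. 6.8 (i) p. 74 in its typed form
`TemperedCurve.DLocEquivalence X D.toDLocContext` follows from T68i-L03 (essentially surjective) and
T68i-L04a/b (full, faithful): an equivalence of categories is by definition a full, faithful,
essentially surjective functor (Mathlib `Functor.IsEquivalence`). PROVED (bookkeeping only; the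
content is in the three inputs). [cite: MochizukiSemiAnbd2006, Thm 6.8(i) p.74] -/
theorem dlocEquivalence_of_parts (X : TemperedCurve p) (D : DLocSchemeData X)
    (hF : PiFunctorFull X D) (hf : PiFunctorFaithful X D) (hE : PiFunctorEssSurj X D) :
    X.DLocEquivalence D.toDLocContext := by
  letI := D.catK; letI := DLocObj.dlocCategory X
  exact ⟨hf, hF, hE⟩

/-! ### B. The mechanism of [Mzk8] Cor. 2.5 (used by (ii), (iii), (iv))

[Mzk8] Cor. 2.5, p. 9: an isomorphism `α` "preserves the decomposition groups of `DLoc`-type", proof: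
"This follows immediately from the definitions; Theorem 2.3 [and its proof]; Theorem 1.3, (ii),
(iii)" — tempered rôles: Thm. 6.8 (i)(ii), Thm. 6.5 (ii) (commensurable terminality), Thm. 6.5 (iii)
(cuspidal decomposition groups are preserved).  The typed conclusion is t4's
`TemperedCurve.IsoPreservesTemperedDLocType` (NODES owner abc-iut-L3-t4; not restated).  The two
tacit group-theoretic steps are isolated and PROVED below; the tacit topological one is typed. -/

/-- **T68-B1 (tacit, p. 71)**: decomposition groups are COMPACT — `D_x` is an extension of an open
subgroup of the profinite group `G_K` ("`D_x` always surjects onto an open subgroup of `G_K`") by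
`I_x ≅ Ẑ(1)` or `{1}` (p. 71); used in the form "an open subgroup of `D_x` has finite index in `D_x`".
Typed, not proved (the interface `TemperedCurve` records the two printed facts but not compactness).
[cite: MochizukiSemiAnbd2006, §6 p.71] -/
def DecompCompact (X : TemperedCurve p) : Prop :=
  ∀ x : X.Pt, IsCompact (X.decomp x : Set X.PiTemp)

/-- **T68-B2 (tacit group theory, PROVED)**: if `U ≤ D'` has finite index in `D'` and `U ≤ D` has
finite index in `D`, and `D` is its own commensurator, then `D' ≤ D`.  This is the step "image of a
cuspidal decomposition group is an OPEN subgroup of `D_x` … `D_x` is commensurably terminal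
(Thm. 6.5 (ii)) … hence `α` carries `D_x` INTO a decomposition group" of [Mzk8] Cor. 2.5.
[cite: MochizukiGalSect2005, Cor 2.5 p.9] -/
theorem le_of_finiteIndex_le_of_commensurator_eq {G : Type u} [Group G] {U D D' : Subgroup G}
    (hUD' : U ≤ D') (hiD' : (U.subgroupOf D').FiniteIndex) (hUD : U ≤ D)
    (hiD : (U.subgroupOf D).FiniteIndex) (hD : Subgroup.Commensurable.commensurator D = D) :
    D' ≤ D := by
  -- `U` is commensurable with `D` and with `D'`
  have hcD : Subgroup.Commensurable U D :=
    ⟨hiD.index_ne_zero, by rw [Subgroup.relIndex_eq_one.2 hUD]; exact one_ne_zero⟩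
  have hcD' : Subgroup.Commensurable U D' :=
    ⟨hiD'.index_ne_zero, by rw [Subgroup.relIndex_eq_one.2 hUD']; exact one_ne_zero⟩
  -- every element of `D'` commensurates `D'`, hence `U`, hence `D`
  intro g hg
  have hgD' : g ∈ Subgroup.Commensurable.commensurator D' := by
    rw [Subgroup.Commensurable.commensurator_mem_iff]
    have : ConjAct.toConjAct g • D' = D' := by
      ext y
      rw [Subgroup.mem_smul_pointwise_iff_exists]
      constructor
      · rintro ⟨d, hd, rfl⟩
        simpa [ConjAct.smul_def] using D'.mul_mem (D'.mul_mem hg hd) (D'.inv_mem hg)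
      · intro hy
        refine ⟨g⁻¹ * y * g, D'.mul_mem (D'.mul_mem (D'.inv_mem hg) hy) hg, ?_⟩
        simp [ConjAct.smul_def, mul_assoc]
    rw [this]
  rw [← hcD'.eq, hcD.eq, hD] at hgD'
  exact hgD'

/-- **T68-B3 (tacit group theory, PROVED)**: a commensurably terminal subgroup `D` is recovered from
its intersection with any subgroup `U` in which that intersection has finite index relative to `D`:
`C(D ∩ U) = D` whenever `D ∩ U` has finite index in `D`.  This is the mechanism behind "by Theorem
6.5, (ii), we may always enlarge `K`, `L`" ([Mzk8] proof of Cor. 2.8, p. 11 l. 3–4): decomposition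
groups over `K` are the commensurators of the decomposition groups over a finite extension `K'`
(`U = Π^temp_{X_{K'}}`, open of finite index). [cite: MochizukiGalSect2005, Cor 2.8 p.11] -/
theorem commensurator_inf_eq_of {G : Type u} [Group G] {D U : Subgroup G}
    (hi : ((D ⊓ U).subgroupOf D).FiniteIndex) (hD : Subgroup.Commensurable.commensurator D = D) :
    Subgroup.Commensurable.commensurator (D ⊓ U) = D := by
  have hc : Subgroup.Commensurable (D ⊓ U) D :=
    ⟨hi.index_ne_zero, by rw [Subgroup.relIndex_eq_one.2 inf_le_left]; exact one_ne_zero⟩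
  rw [hc.eq, hD]

/-- **T68-B4 (tacit, scheme side)** — [Mzk8] Def. 2.4 / Cor. 2.5 p. 9, tempered Def. 6.7 p. 74: the
image of a cuspidal decomposition group `D_z ⊆ Π^temp_Z` under (a representative of) the outer
homomorphism induced by a morphism `Z → X_K` of `DLoc_K(X_K)` is an OPEN subgroup of (a conjugate
of) the decomposition group `D_{f(z)}` of the image point ("`D_x` admits an open subgroup that arises
as the image …").  Typed over the scheme-side interface; not proved.
[cite: MochizukiSemiAnbd2006, Def 6.7 p.74] -/
def CuspImageOpenInDecomp (X : TemperedCurve p) (D : DLocSchemeData X) : Prop :=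
  letI := D.catK; letI := DLocObj.dlocCategory X
  ∀ (Z : D.DLocK) (f : Z ⟶ D.self) (Dz : Subgroup (D.curve Z).PiTemp),
    (D.curve Z).IsCuspidalDecompositionGroup Dz →
    ∃ (x : X.Pt) (γ : ConjAct X.PiTemp),
      let img : Subgroup X.PiTemp :=
        γ • (Dz.map (D.pi1 f).toMonoidHom).map D.selfIso.toMulEquiv.toMonoidHom
      img ≤ X.decomp x ∧
        IsOpen ((img.subgroupOf (X.decomp x) : Subgroup (X.decomp x)) : Set (X.decomp x))

/-! ### C. Clause (iii): once-punctured elliptic curves ([Mzk8] Cor. 2.6, proof p. 10) -/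

/-- **T68iii-L01 (the "multiplication by `n`" covering, group-theoretically)** — [Mzk8] proof of
Cor. 2.6, p. 10: for `X_K` a once-punctured elliptic curve and `n ≥ 1`, the finite étale covering
`φ : Z_K → X_K` "determined by multiplication by `n`" "may also be described more group-theoretically
as the covering associated to the open subgroup `H ⊆ Π_{X_K}` [unique up to conjugation] such that:
(i) `H` contains a cuspidal decomposition group of `Π_{X_K}`; (ii) `H ∩ Δ_X` is equal to the inverse
image in `Δ_X` of the subgroup `n · Δ^ab_X ⊆ Δ^ab_X`."  READING (flagged): print ([Mzk8]) has the
PROFINITE `Δ_X`; the tempered transcription ("exactly the same arguments", [SemiAnbd] p. 75) is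
written with `Δ^temp_X` and its abelianization — for an open subgroup of finite index the two
descriptions cut out the same `H`. [cite: MochizukiGalSect2005, Cor 2.6 p.10] -/
def IsMulNSubgroup (X : TemperedCurve p) (n : ℕ) (H : Subgroup X.PiTemp) : Prop :=
  IsOpen (H : Set X.PiTemp) ∧ H.FiniteIndex ∧
    (∃ Dc : Subgroup X.PiTemp, X.IsCuspidalDecompositionGroup Dc ∧ Dc ≤ H) ∧
    ∀ δ : X.DeltaTemp, ((δ : X.PiTemp) ∈ H ↔
      Abelianization.of δ ∈ (powMonoidHom n : Abelianization X.DeltaTemp →* _).range)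

/-- **T68iii-L02 (existence and uniqueness up to conjugation)** — [Mzk8] p. 10 "[which is easily
verified to be unique, up to conjugation in `Π_{X_K}`]", for every `n ≥ 1`, when `X_K` is a
once-punctured elliptic curve (flag of `CurveArithmeticFlags`). [cite: MochizukiGalSect2005, Cor 2.6 p.10] -/
def MulNSubgroupExistsUnique (X : TemperedCurve p) (a : TemperedCurve.CurveArithmeticFlags X) : Prop :=
  a.IsOncePuncturedElliptic → ∀ n : ℕ, 1 ≤ n →
    (∃ H, IsMulNSubgroup X n H) ∧
      ∀ H H' : Subgroup X.PiTemp, IsMulNSubgroup X n H → IsMulNSubgroup X n H' →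
        ∃ γ : ConjAct X.PiTemp, H' = γ • H

/-- **T68iii-L03 (the `[n]`-object of `DLoc_K(X_K)` and its open immersion to `X_K`)** — [Mzk8]
p. 10: "`Z_K` admits `X_K` as an HPC, by 'filling in' all of the cusps other than the 'origin'. Thus,
we obtain an open immersion `ψ : Z_K ↪ X_K` — i.e., an object of `DLoc_K(X_K)`".  Typed as: there is
an object `Zn` of `DLoc_K(X_K)` (the trivial partial compactification of `Z_K`) whose open subgroup
is a multiplication-by-`n` subgroup and no cusp filled in, together with a morphism `ψ : Zn → X_K`
to the object `X_K` whose induced homomorphism is, up to an inner automorphism, the INCLUSION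
`Π^temp_{Z_K} = H ⊆ Π^temp_{X_K}` (an open immersion induces the inclusion of an open subgroup).
Scheme side = INTERFACE. [cite: MochizukiGalSect2005, Cor 2.6 p.10] -/
def MulNObject (X : TemperedCurve p) (D : DLocSchemeData X)
    (a : TemperedCurve.CurveArithmeticFlags X) : Prop :=
  letI := D.catK; letI := DLocObj.dlocCategory X
  a.IsOncePuncturedElliptic → ∀ n : ℕ, 1 ≤ n →
    ∃ (Zn : D.DLocK) (ψ : Zn ⟶ D.self),
      IsMulNSubgroup X n (D.pi1Functor.obj Zn).H ∧ (D.pi1Functor.obj Zn).gens = ∅ ∧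
        ∃ c : X.PiTemp, ∀ h : (D.pi1Functor.obj Zn).H,
          D.selfIso (D.pi1 ψ (D.objIso Zn ((D.pi1Functor.obj Zn).proj h))) =
            c * (h : X.PiTemp) * c⁻¹

/-- **T68iii-L04 (torsion closed points are exactly the points exhibited by the `[n]`-objects)** —
[Mzk8] p. 10: the object `ψ : Z_K ↪ X_K` "exhibits the closed points of `X_K` that arise from
`n`-torsion points of the underlying elliptic curve as closed points of `DLoc`-type"; i.e. a closed
point is a torsion closed point iff, for some `n ≥ 1`, some cusp of `Z_K` (= some `n`-torsion point)
maps to it under `ψ`: its decomposition group contains, as an open subgroup, the image of a cuspidal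
decomposition group of `Π^temp_{Z_K}`.  The left side reads "torsion closed point OR the cusp" so that
the statement does not depend on whether the flag counts the origin (the unique cusp, exhibited by the
cusp of `Z_K` over it) among the torsion closed points.  Scheme side = INTERFACE.
[cite: MochizukiGalSect2005, Cor 2.6 p.10] -/
def TorsionIffMulNCuspImage (X : TemperedCurve p) (D : DLocSchemeData X)
    (a : TemperedCurve.CurveArithmeticFlags X) : Prop :=
  letI := D.catK; letI := DLocObj.dlocCategory X
  a.IsOncePuncturedElliptic → ∀ x : X.Pt, (a.IsTorsionPt x ∨ X.IsCusp x) ↔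
    ∃ (n : ℕ) (_ : 1 ≤ n) (Zn : D.DLocK) (ψ : Zn ⟶ D.self),
      IsMulNSubgroup X n (D.pi1Functor.obj Zn).H ∧ (D.pi1Functor.obj Zn).gens = ∅ ∧
      ∃ (Dz : Subgroup (D.curve Zn).PiTemp) (γ : ConjAct X.PiTemp),
        (D.curve Zn).IsCuspidalDecompositionGroup Dz ∧
        let img : Subgroup X.PiTemp :=
          γ • (Dz.map (D.pi1 ψ).toMonoidHom).map D.selfIso.toMulEquiv.toMonoidHom
        img ≤ X.decomp x ∧
          IsOpen ((img.subgroupOf (X.decomp x) : Subgroup (X.decomp x)) : Set (X.decomp x))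

/-- **T68iii-L05 (torsion ⇒ tempered `DLoc`-type)** — the printed conclusion of the previous row in
the vocabulary of Def. 6.7 (`TemperedCurve.IsTemperedDLocType`): every torsion closed point of a
once-punctured elliptic curve is of tempered `DLoc`-type. [cite: MochizukiGalSect2005, Cor 2.6 p.10] -/
def TorsionIsTemperedDLocType (X : TemperedCurve p) (D : DLocSchemeData X)
    (a : TemperedCurve.CurveArithmeticFlags X) : Prop :=
  a.IsOncePuncturedElliptic → ∀ x : X.Pt, a.IsTorsionPt x → X.IsTemperedDLocType D.toDLocContext x

/-- **T68iii-L06 (transport of the `[n]`-subgroups along `α`)** — [Mzk8] p. 10 "by transporting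
`φ`, `ψ` via the equivalences of Theorem 2.3, (i), and applying Theorem 1.3, (ii), (iii)": an
isomorphism `α : Π^temp_{X_K} ⥲ Π^temp_{Y_L}` with `α(Δ^temp_X) = Δ^temp_Y` carries
multiplication-by-`n` subgroups to multiplication-by-`n` subgroups — condition (i) by [SemiAnbd]
Thm. 6.5 (iii) (`TemperedCurve.IsoPreservesCuspidalDecomp`), condition (ii) by the naturality of
abelianization.  Group theory over the interface; typed, proof left to the discharge board.
[cite: MochizukiGalSect2005, Cor 2.6 p.10] -/
def MulNSubgroupTransport (X Y : TemperedCurve p) (α : X.PiTemp ≃ₜ* Y.PiTemp) : Prop :=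
  X.DeltaTemp.map α.toMulEquiv.toMonoidHom = Y.DeltaTemp → X.IsoPreservesCuspidalDecomp Y →
    ∀ (n : ℕ) (H : Subgroup X.PiTemp), IsMulNSubgroup X n H →
      IsMulNSubgroup Y n (H.map α.toMulEquiv.toMonoidHom)

/-! ### D. Clause (iv): curves isogenous to genus zero ([Mzk8] Def. 2.7, Cor. 2.8, proof p. 11) -/

/-- **T68iv-L01 (enlarging the base field)** — [Mzk8] proof of Cor. 2.8, p. 11 l. 3–4: "by Theorem
1.3, (ii) [tempered: Thm. 6.5 (ii)], we may always enlarge `K`, `L` without loss of generality":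
for an open subgroup of finite index `U = Π^temp_{X_{K'}} ⊆ Π^temp_{X_K}` the decomposition groups
over `K` are recovered from those over `K'` as commensurators, `D_x = C_{Π^temp_{X_K}}(D_x ∩ U)`.
Typed; it FOLLOWS from `TemperedCurve.DecompCommensurablyTerminal` and compactness (T68-B1) by
`commensurator_inf_eq_of` (T68-B3) once `D_x ∩ U` is known to have finite index in `D_x`.
[cite: MochizukiGalSect2005, Cor 2.8 p.11] -/
def DecompRecoveredFromOpenSubgroup (X : TemperedCurve p) : Prop :=
  ∀ (x : X.Pt) (U : Subgroup X.PiTemp), IsOpen (U : Set X.PiTemp) → U.FiniteIndex →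
    Subgroup.Commensurable.commensurator (X.decomp x ⊓ U) = X.decomp x

/-- T68iv-L01 from Thm. 6.5 (ii) and the finite-index property of `D_x ∩ U ⊆ D_x` (PROVED
bookkeeping; the finite-index property is where compactness T68-B1 enters).
[cite: MochizukiGalSect2005, Cor 2.8 p.11] -/
theorem decompRecovered_of (X : TemperedCurve p) (hct : X.DecompCommensurablyTerminal)
    (hfi : ∀ (x : X.Pt) (U : Subgroup X.PiTemp), IsOpen (U : Set X.PiTemp) → U.FiniteIndex →
      ((X.decomp x ⊓ U).subgroupOf (X.decomp x)).FiniteIndex) :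
    DecompRecoveredFromOpenSubgroup X :=
  fun x U hU hUi => commensurator_inf_eq_of (hfi x U hU hUi) (hct x)

/-- **T68iv-L04 (Belyi ⇒ algebraic points are of `DLoc`-type)** — [Mzk8] proof of Cor. 2.8, p. 11
l. 4–16, with Def. 2.7 / Rmk. 2.7.1 (algebraic closed points) and "the famous main result of [Belyi]":
after reducing to genus zero (l. 1–3) and enlarging `K` so that `X_K` is cuspidally split with a tripod
HPC (l. 4–6), for `x ∈ X̄_K` ALGEBRAIC "there exists … a 'Belyi map' `β : X̄_K → X̄_K` that maps `x`,
as well as all of the cusps of `X_K`, to cusps of `X̄_K`, and … is unramified over … `X_K ⊆ X̄_K`. Put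
another way, there exists an open immersion `φ : Z_K ↪ X_K` such that … `β_Z : Z_K → X_K` is finite
étale. In particular, `β_Z` exhibits `φ` as an object of `DLoc_K(X_K)`, and so `φ` exhibits `x` as a
closed point of `DLoc`-type."  Typed as the printed CONSEQUENCE, in the vocabulary of Def. 6.7, for a
curve isogenous to genus zero over its own base field (the genus-zero reduction, the enlargement of `K`
— witnesses over `K'` are witnesses over `K`, cf. T68iv-L01 — and [Belyi] are the inputs BY NAME;
nothing of them is asserted). [cite: MochizukiGalSect2005, Cor 2.8 p.11] -/
def AlgebraicIsTemperedDLocType (X : TemperedCurve p) (D : DLocSchemeData X)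
    (a : TemperedCurve.CurveArithmeticFlags X) : Prop :=
  a.IsIsogenousToGenusZero → ∀ x : X.Pt, a.IsAlgebraicPt x → X.IsTemperedDLocType D.toDLocContext x

/-- **T68iv-L05 (definability over a number field ⇔ an algebraic point exists)** — [Mzk8]
Cor. 2.8, p. 11: "`X_K` is defined over a number field [or, equivalently: `X_K` has at least one
algebraic point]" (Def. 2.7: a closed point is algebraic only relative to an isomorphism of `X_L`
with the base change of a curve over a number field; conversely the cusps of such a curve are
algebraic).  Typed over the flags. [cite: MochizukiGalSect2005, Def 2.7, Cor 2.8 pp.10-11] -/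
def DefinedOverNFIffExistsAlgebraic (X : TemperedCurve p)
    (a : TemperedCurve.CurveArithmeticFlags X) : Prop :=
  a.IsDefinedOverNumberField ↔ ∃ x : X.Pt, a.IsAlgebraicPt x

/-- **T68iv-L06 (the "in particular" of (iv))** — [SemiAnbd] Thm. 6.8 (iv) p. 75, second
sentence, `TemperedCurve.DefinedOverNumberFieldIff`, from the first sentence
(`TemperedCurve.IsoPreservesAlgebraicDecomp`) and T68iv-L05 for both curves: a bijection between
conjugacy classes of decomposition groups of algebraic points makes "has an algebraic point"
equivalent for `X_K` and `Y_L`.  PROVED (bookkeeping). [cite: MochizukiSemiAnbd2006, Thm 6.8(iv) p.75] -/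
theorem definedOverNumberFieldIff_of (X Y : TemperedCurve p)
    (aX : TemperedCurve.CurveArithmeticFlags X) (aY : TemperedCurve.CurveArithmeticFlags Y)
    (hX : DefinedOverNFIffExistsAlgebraic X aX) (hY : DefinedOverNFIffExistsAlgebraic Y aY)
    (h : ∀ α : X.PiTemp ≃ₜ* Y.PiTemp, X.IsoPreservesAlgebraicDecomp Y aX aY α) :
    X.DefinedOverNumberFieldIff Y aX aY := by
  intro hgX hgY ⟨α⟩
  have hα := h α hgX hgY
  change _ ↔ _ at hX hY
  rw [hX, hY]
  constructor
  · rintro ⟨x, hx⟩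
    obtain ⟨y, hy, -⟩ := (hα (X.decomp x)).1 ⟨x, hx, 1, (one_smul _ _).symm⟩
    exact ⟨y, hy⟩
  · rintro ⟨y, hy⟩
    -- use the inverse direction of the bijection at the decomposition group `α⁻¹(D_y)`
    have hback : ((Y.decomp y).map α.symm.toMulEquiv.toMonoidHom).map α.toMulEquiv.toMonoidHom =
        Y.decomp y := by
      rw [Subgroup.map_map]
      conv_rhs => rw [← Subgroup.map_id (Y.decomp y)]
      congr 1
      ext g
      exact α.apply_symm_apply g
    obtain ⟨x, hx, -⟩ := (hα ((Y.decomp y).map α.symm.toMulEquiv.toMonoidHom)).2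
      ⟨y, hy, 1, by rw [one_smul, hback]⟩
    exact ⟨x, hx⟩

/-! ### R. Remark 6.8.1 / [Mzk8] Remark 2.8.1: arrows of OF-type ("open immersion + finite étale") -/

/-- **T68-R1 (arrows of OF-type, group-theoretic side)** — [Mzk8] Rmk. 2.8.1, p. 12: in
`DLoc_{G_K}(Π_{X_K})`, `OFLoc` is "the collection of arrows `J₁ → J₂` … that factor as the composite
of a surjection `J₁ ↠ J₃` whose kernel is normally topologically generated by some collection of
cuspidal geometric decomposition groups, with an open immersion `J₃ ↪ J₂`"; the proofs of (iii),
(iv) "only make use of arrows of OF-type", whence Rmk. 6.8.1 ("only require the isomorphism version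
of Theorem 6.4").  Typed for a representative `J₁ → J₂`: its kernel is the closed normal subgroup
generated by (images in `J₁` of) cuspidal geometric decomposition groups of `Π^temp_{X_K}` meeting
`H₁`, and its image is an open subgroup of finite index. [cite: MochizukiGalSect2005, Rmk 2.8.1 p.12] -/
def IsOFTypeRep {X : TemperedCurve p} {A B : DLocObj X} (φ : DLocObj.HomRep A B) : Prop :=
  (∃ gens : Set (Subgroup X.PiTemp),
      (∀ I ∈ gens, ∃ I₀, X.IsCuspidalGeometricDecompositionGroup I₀ ∧ I = A.H ⊓ I₀) ∧
      φ.toHom.toMonoidHom.ker =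
        (Subgroup.normalClosure
          (⋃ I ∈ gens, ((((I.subgroupOf A.H).map A.proj.toMonoidHom : Subgroup A.J)) : Set A.J))).topologicalClosure) ∧
    IsOpen (φ.toHom.toMonoidHom.range : Set B.J) ∧ φ.toHom.toMonoidHom.range.FiniteIndex

/-- **T68-R2 (OF-arrows are transported by (ii) using Thm. 6.5 (iii) only)** — [Mzk8] Rmk. 2.8.1
p. 12: the equivalence `DLoc_{G_K}(Π_{X_K}) ⥲ DLoc_{G_L}(Π_{Y_L})` of (ii) "maps `OFLoc_K(Π_{X_K})` into
`OFLoc_L(Π_{Y_L})` by applying Proposition 1.1, (ii); Theorem 1.3, (iii) [i.e., without using Theorem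
1.2 at all!]".  Typed for abc-iut-L3-t4's transport of representatives along `α`
(`DLocObj.HomRep.transport`, `TemperedDLocTransport.lean`) under its hypotheses (hI) = Thm. 6.5 (iii)
for cuspidal geometric decomposition groups and (hΔ). [cite: MochizukiGalSect2005, Rmk 2.8.1 p.12] -/
def OFRepsTransported (X Y : TemperedCurve p) (α : X.PiTemp ≃ₜ* Y.PiTemp)
    (hI : ∀ I : Subgroup X.PiTemp, X.IsCuspidalGeometricDecompositionGroup I →
      Y.IsCuspidalGeometricDecompositionGroup (I.map α.toMulEquiv.toMonoidHom))
    (hΔ : X.DeltaTemp.map α.toMulEquiv.toMonoidHom = Y.DeltaTemp) : Prop :=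
  ∀ (A B : DLocObj X) (φ : DLocObj.HomRep A B), IsOFTypeRep φ →
    IsOFTypeRep (DLocObj.HomRep.transport α hI hΔ φ)

end Thm68Sub

end Literature.AnabelianGeometry.SemiGraphs

end
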